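import Summits.Ventures.PercRepro.ProfileTwoFat
import Summits.Ventures.PercRepro.RankLevelSetCircuitCount
import Summits.Ventures.PercRepro.RankLevelSetPlaneTenTraces
import Summits.Ventures.PercRepro.RankLevelSetPlaneSix

/-!
# PercRepro — the parallel classes of `M ／ {e}` on the e-free core and their representatives (p3 g21, module 2 of 5)

For a point `e` of the e-free core `M`, the class of `x ≠ e` is `cls M e x = {y ≠ e : r{e, x, y} ≤ 2}` (the parallel
class of `x` in `N = M ／ {e}`): an equivalence on `E ∖ {e}` (`mem_cls_trans`, `mem_cls_symm`, `cls_eq_of_mem`)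
whose classes have at most two points (`ncard_cls_le_two`: with `e` a class is a line of the core).  Each class
gets a representative `rep M e x` (`rep_rep`, `rep_eq_of_mem_cls`).  In `N`: `r_N(X) + 1 = r_M(X ∪ {e})`
(`eRk_contract_add_one`), points have rank `1`, two points of different classes rank `2`.  Deleting one
non-representative of every fat class gives `N′ = Nprime M e` — the representatives' matroid, of the same rank as
`N` (`Nprime_eRank`: every point lies in the closure of its representative) and nullity `d − |delSet|`
(`Nprime_nullity`).  These feed the cost clause of the 4-circuit-cap bridge (p1's cost model on `N′`).
Axioms: standard.
-/

open scoped Matroid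

namespace PercRepro

namespace FourCircuitCap

open Set

variable {α : Type}

/-! ### The parallel classes of `M ／ {e}` and their representatives -/

/-- The class of `x` in `M ／ {e}`: the points `y ≠ e` of `M` with `{e, x, y}` of rank `≤ 2`. -/
def cls (M : Matroid α) (e x : α) : Set α := {y | y ∈ M.E ∧ y ≠ e ∧ M.eRk {e, x, y} ≤ 2}

open Classical in
/-- A chosen member of a set (`e` for the empty set). -/
noncomputable def repOf (e : α) (c : Set α) : α := if h : c.Nonempty then h.choose else e

/-- The representative of the class of `x`. -/
noncomputable def rep (M : Matroid α) (e x : α) : α := repOf e (cls M e x)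

/-- Membership in a class, unfolded. -/
theorem mem_cls {M : Matroid α} {e x y : α} :
    y ∈ cls M e x ↔ y ∈ M.E ∧ y ≠ e ∧ M.eRk {e, x, y} ≤ 2 := Iff.rfl

/-- A class lies in the ground set. -/
theorem cls_subset_ground (M : Matroid α) (e x : α) : cls M e x ⊆ M.E := fun _ h => h.1

/-- A member of a class is not `e`. -/
theorem ne_of_mem_cls {M : Matroid α} {e x y : α} (h : y ∈ cls M e x) : y ≠ e := h.2.1

/-- `x` lies in its own class. -/
theorem mem_cls_self (M : Matroid α) {e x : α} (hx : x ∈ M.E) (hxe : x ≠ e) : x ∈ cls M e x := by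
  refine ⟨hx, hxe, ?_⟩
  have : ({e, x, x} : Set α) = {e, x} := by
    ext z; simp
  rw [this]
  calc M.eRk {e, x} ≤ ({e, x} : Set α).encard := M.eRk_le_encard _
    _ ≤ 2 := by
      calc ({e, x} : Set α).encard ≤ ({x} : Set α).encard + 1 := encard_insert_le _ _
        _ = 2 := by rw [encard_singleton]; norm_num

/-- The chosen member of a nonempty set lies in it. -/
theorem repOf_mem {e : α} {c : Set α} (hc : c.Nonempty) : repOf e c ∈ c := by
  unfold repOf
  rw [dif_pos hc]
  exact hc.choose_spec

/-- The representative of the class of `x ∈ E ∖ {e}` lies in that class. -/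
theorem rep_mem_cls (M : Matroid α) {e x : α} (hx : x ∈ M.E) (hxe : x ≠ e) : rep M e x ∈ cls M e x :=
  repOf_mem ⟨x, mem_cls_self M hx hxe⟩

/-- A representative lies in the ground set. -/
theorem rep_mem_ground (M : Matroid α) {e x : α} (hx : x ∈ M.E) (hxe : x ≠ e) : rep M e x ∈ M.E :=
  (rep_mem_cls M hx hxe).1

/-- A representative is not `e`. -/
theorem rep_ne (M : Matroid α) {e x : α} (hx : x ∈ M.E) (hxe : x ≠ e) : rep M e x ≠ e :=
  (rep_mem_cls M hx hxe).2.1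

/-- Equal classes have equal representatives. -/
theorem rep_eq_of_cls_eq {M : Matroid α} {e x y : α} (h : cls M e x = cls M e y) : rep M e x = rep M e y := by
  unfold rep; rw [h]

/-- On the e-free core, `{e, y}` has rank `2` for `y ≠ e`. -/
theorem eRk_pair_eq_two_of_free (M : Matroid α) [M.Finite]
    (hfree : ∀ e ∈ M.E, ∃ A ⊆ M.E \ {e}, e ∉ M.closure A ∧ e ∉ M.closure ((M.E \ {e}) \ A))
    {e y : α} (he : e ∈ M.E) (hy : y ∈ M.E) (hye : y ≠ e) : M.eRk {e, y} = 2 := by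
  have h2 : (2 : ℕ∞) ≤ M.eRk {e, y} := by
    refine ThmN.two_le_eRk_of_two_le_ncard_of_free M hfree (by
      intro z hz; rcases hz with rfl | rfl <;> assumption) ?_
    rw [ncard_pair hye.symm]
  have h2' : M.eRk {e, y} ≤ 2 := by
    calc M.eRk {e, y} ≤ ({e, y} : Set α).encard := M.eRk_le_encard _
      _ ≤ 2 := by
        calc ({e, y} : Set α).encard ≤ ({y} : Set α).encard + 1 := encard_insert_le _ _
          _ = 2 := by rw [encard_singleton]; norm_num
  exact le_antisymm h2' h2

/-- The class relation is transitive on the e-free core: `y ∈ cls x` and `z ∈ cls y` give `z ∈ cls x`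
(submodularity on `{e, x, y} ∪ {e, y, z}`, whose intersection contains the rank-`2` pair `{e, y}`). -/
theorem mem_cls_trans (M : Matroid α) [M.Finite]
    (hfree : ∀ e ∈ M.E, ∃ A ⊆ M.E \ {e}, e ∉ M.closure A ∧ e ∉ M.closure ((M.E \ {e}) \ A))
    {e x y z : α} (he : e ∈ M.E) (hy : y ∈ cls M e x) (hz : z ∈ cls M e y) : z ∈ cls M e x := by
  refine ⟨hz.1, hz.2.1, ?_⟩
  have hsub := M.eRk_inter_add_eRk_union_le {e, x, y} {e, y, z}
  have hint : (2 : ℕ∞) ≤ M.eRk ({e, x, y} ∩ {e, y, z}) := by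
    rw [← eRk_pair_eq_two_of_free M hfree he hy.1 hy.2.1]
    exact M.eRk_mono (by intro w hw; rcases hw with rfl | rfl <;> simp)
  have hun : M.eRk ({e, x, y} ∪ {e, y, z}) ≤ 2 := by
    have h4 : M.eRk ({e, x, y} ∩ {e, y, z}) + M.eRk ({e, x, y} ∪ {e, y, z}) ≤ (2 : ℕ∞) + 2 :=
      hsub.trans (add_le_add hy.2.2 hz.2.2)
    have hfin : M.eRk ({e, x, y} ∩ {e, y, z}) ≠ ⊤ :=
      ((M.eRk_le_encard _).trans_lt ((Set.toFinite _).encard_lt_top)).ne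
    obtain ⟨a, ha⟩ := ENat.ne_top_iff_exists.1 hfin
    have hfin2 : M.eRk ({e, x, y} ∪ {e, y, z}) ≠ ⊤ :=
      ((M.eRk_le_encard _).trans_lt ((Set.toFinite _).encard_lt_top)).ne
    obtain ⟨b, hb⟩ := ENat.ne_top_iff_exists.1 hfin2
    rw [← ha, ← hb] at h4
    rw [← ha] at hint
    rw [← hb]
    have h4' : a + b ≤ 4 := by exact_mod_cast h4
    have hint' : 2 ≤ a := by exact_mod_cast hint
    exact_mod_cast (by omega : b ≤ 2)
  exact (M.eRk_mono (by intro w hw; rcases hw with rfl | rfl | rfl <;> simp)).trans hun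

/-- The class relation is symmetric. -/
theorem mem_cls_symm {M : Matroid α} {e x y : α} (hx : x ∈ M.E) (hxe : x ≠ e) (hy : y ∈ cls M e x) :
    x ∈ cls M e y := by
  refine ⟨hx, hxe, ?_⟩
  have : ({e, y, x} : Set α) = {e, x, y} := by ext z; simp only [mem_insert_iff, mem_singleton_iff]; tauto
  rw [this]; exact hy.2.2

/-- Two points of a common class have the same class. -/
theorem cls_eq_of_mem (M : Matroid α) [M.Finite]
    (hfree : ∀ e ∈ M.E, ∃ A ⊆ M.E \ {e}, e ∉ M.closure A ∧ e ∉ M.closure ((M.E \ {e}) \ A))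
    {e x y : α} (he : e ∈ M.E) (hx : x ∈ M.E) (hxe : x ≠ e) (hy : y ∈ cls M e x) :
    cls M e y = cls M e x := by
  ext z
  constructor
  · intro hz; exact mem_cls_trans M hfree he hy hz
  · intro hz; exact mem_cls_trans M hfree he (mem_cls_symm hx hxe hy) hz

/-- The representative of `x` has the class of `x`, and the representative of a member of the class is the
representative of `x`. -/
theorem cls_rep (M : Matroid α) [M.Finite]
    (hfree : ∀ e ∈ M.E, ∃ A ⊆ M.E \ {e}, e ∉ M.closure A ∧ e ∉ M.closure ((M.E \ {e}) \ A))
    {e x : α} (he : e ∈ M.E) (hx : x ∈ M.E) (hxe : x ≠ e) : cls M e (rep M e x) = cls M e x :=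
  cls_eq_of_mem M hfree he hx hxe (rep_mem_cls M hx hxe)

/-- Representatives are idempotent: `rep (rep x) = rep x`. -/
theorem rep_rep (M : Matroid α) [M.Finite]
    (hfree : ∀ e ∈ M.E, ∃ A ⊆ M.E \ {e}, e ∉ M.closure A ∧ e ∉ M.closure ((M.E \ {e}) \ A))
    {e x : α} (he : e ∈ M.E) (hx : x ∈ M.E) (hxe : x ≠ e) : rep M e (rep M e x) = rep M e x :=
  rep_eq_of_cls_eq (cls_rep M hfree he hx hxe)

/-- A member of the class of `x` has the representative of `x`. -/
theorem rep_eq_of_mem_cls (M : Matroid α) [M.Finite]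
    (hfree : ∀ e ∈ M.E, ∃ A ⊆ M.E \ {e}, e ∉ M.closure A ∧ e ∉ M.closure ((M.E \ {e}) \ A))
    {e x y : α} (he : e ∈ M.E) (hx : x ∈ M.E) (hxe : x ≠ e) (hy : y ∈ cls M e x) :
    rep M e y = rep M e x :=
  rep_eq_of_cls_eq (cls_eq_of_mem M hfree he hx hxe hy)

/-- A class lies in the closure of `{e, x}`: the whole class with `e` has rank `≤ 2`. -/
theorem insert_cls_subset_closure (M : Matroid α) [M.Finite]
    (hfree : ∀ e ∈ M.E, ∃ A ⊆ M.E \ {e}, e ∉ M.closure A ∧ e ∉ M.closure ((M.E \ {e}) \ A))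
    {e x : α} (he : e ∈ M.E) (hx : x ∈ M.E) (hxe : x ≠ e) :
    insert e (cls M e x) ⊆ M.closure {e, x} := by
  intro y hy
  rcases hy with rfl | hy
  · exact M.mem_closure_of_mem (by simp) (by intro z hz; rcases hz with rfl | rfl <;> assumption)
  · by_contra hnot
    have h := M.eRk_insert_eq_add_one (X := {e, x}) ⟨hy.1, hnot⟩
    rw [eRk_pair_eq_two_of_free M hfree he hx hxe] at h
    have : ({e, x, y} : Set α) = insert y {e, x} := by ext z; simp only [mem_insert_iff, mem_singleton_iff]; tauto
    have h2 := hy.2.2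
    rw [this, h] at h2
    have : (2 : ℕ∞) + 1 ≤ 2 := h2
    exact absurd this (by norm_num)

/-- A class has at most two points (with `e` it is a line of the Core). -/
theorem ncard_cls_le_two (M : Matroid α) [M.Finite]
    (hfree : ∀ e ∈ M.E, ∃ A ⊆ M.E \ {e}, e ∉ M.closure A ∧ e ∉ M.closure ((M.E \ {e}) \ A))
    {e x : α} (he : e ∈ M.E) (hx : x ∈ M.E) (hxe : x ≠ e) : (cls M e x).ncard ≤ 2 := by
  have hsub := insert_cls_subset_closure M hfree he hx hxe
  have hr : M.eRk (insert e (cls M e x)) ≤ 2 := by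
    calc M.eRk (insert e (cls M e x)) ≤ M.eRk (M.closure {e, x}) := M.eRk_mono hsub
      _ = M.eRk {e, x} := M.eRk_closure_eq _
      _ = 2 := eRk_pair_eq_two_of_free M hfree he hx hxe
  have h3 := ThmN.ncard_le_three_of_eRk_le_two_of_free M hfree
    (insert_subset he (cls_subset_ground M e x)) hr
  have hfin : (cls M e x).Finite := M.ground_finite.subset (cls_subset_ground M e x)
  have hnot : e ∉ cls M e x := fun h => h.2.1 rfl
  rw [ncard_insert_of_notMem hnot hfin] at h3
  omega

/-! ### Ranks in `N = M ／ {e}`; the representatives' matroid `N′ = N ＼ D` and its nullity -/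

/-- A point of the e-free core is a nonloop: `{e}` is independent. -/
theorem indep_singleton_of_free (M : Matroid α) [M.Finite]
    (hfree : ∀ e ∈ M.E, ∃ A ⊆ M.E \ {e}, e ∉ M.closure A ∧ e ∉ M.closure ((M.E \ {e}) \ A))
    {e : α} (he : e ∈ M.E) : M.Indep {e} :=
  M.indep_singleton.2 ⟨ThmN.not_isLoop_of_free M hfree e he, he⟩

/-- `r_N(X) + 1 = r_M(X ∪ {e})` for `X ⊆ E ∖ {e}` (`N = M ／ {e}`). -/
theorem eRk_contract_add_one (M : Matroid α) [M.Finite]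
    (hfree : ∀ e ∈ M.E, ∃ A ⊆ M.E \ {e}, e ∉ M.closure A ∧ e ∉ M.closure ((M.E \ {e}) \ A))
    {e : α} (he : e ∈ M.E) {X : Set α} (hX : X ⊆ M.E \ {e}) :
    (M ／ {e}).eRk X + 1 = M.eRk (X ∪ {e}) := by
  have h := Cogirth.eRk_contract_add_encard (indep_singleton_of_free M hfree he) hX
  rwa [encard_singleton] at h

/-- A point `v ≠ e` of the core is a nonloop of `N`: `r_N {v} = 1`. -/
theorem eRk_contract_singleton (M : Matroid α) [M.Finite]
    (hfree : ∀ e ∈ M.E, ∃ A ⊆ M.E \ {e}, e ∉ M.closure A ∧ e ∉ M.closure ((M.E \ {e}) \ A))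
    {e v : α} (he : e ∈ M.E) (hv : v ∈ M.E) (hve : v ≠ e) : (M ／ {e}).eRk {v} = 1 := by
  have h := eRk_contract_add_one M hfree he (X := {v}) (by simp [hv, hve])
  have hset : ({v} : Set α) ∪ {e} = {e, v} := by ext z; simp only [mem_union, mem_insert_iff, mem_singleton_iff]; tauto
  rw [hset, eRk_pair_eq_two_of_free M hfree he hv hve] at h
  have hfin : (M ／ {e}).eRk {v} ≠ ⊤ :=
    ((Matroid.eRk_le_encard _ _).trans_lt ((Set.toFinite _).encard_lt_top)).ne
  obtain ⟨a, ha⟩ := ENat.ne_top_iff_exists.1 hfin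
  rw [← ha] at h ⊢
  have h' : a + 1 = 2 := by exact_mod_cast h
  exact_mod_cast (by omega : a = 1)

/-- Two points of different classes span rank `2` in `N`. -/
theorem eRk_contract_pair (M : Matroid α) [M.Finite]
    (hfree : ∀ e ∈ M.E, ∃ A ⊆ M.E \ {e}, e ∉ M.closure A ∧ e ∉ M.closure ((M.E \ {e}) \ A))
    {e v v' : α} (he : e ∈ M.E) (hv : v ∈ M.E) (hve : v ≠ e) (hv' : v' ∈ M.E) (hv'e : v' ≠ e)
    (hnp : v' ∉ cls M e v) : (M ／ {e}).eRk {v, v'} = 2 := by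
  have h := eRk_contract_add_one M hfree he (X := {v, v'}) (by
    intro z hz; rcases hz with rfl | rfl <;> simp [*])
  have hset : ({v, v'} : Set α) ∪ {e} = {e, v, v'} := by ext z; simp only [mem_union, mem_insert_iff, mem_singleton_iff]; tauto
  rw [hset] at h
  have h3 : M.eRk {e, v, v'} ≤ 3 := by
    calc M.eRk {e, v, v'} ≤ ({e, v, v'} : Set α).encard := M.eRk_le_encard _
      _ ≤ 3 := by
        calc ({e, v, v'} : Set α).encard ≤ ({v, v'} : Set α).encard + 1 := encard_insert_le _ _
          _ ≤ ({v'} : Set α).encard + 1 + 1 := by gcongr; exact encard_insert_le _ _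
          _ = 3 := by rw [encard_singleton]; norm_num
  have hgt : ¬ M.eRk {e, v, v'} ≤ 2 := fun hle => hnp ⟨hv', hv'e, hle⟩
  have hfin : (M ／ {e}).eRk {v, v'} ≠ ⊤ :=
    ((Matroid.eRk_le_encard _ _).trans_lt ((Set.toFinite _).encard_lt_top)).ne
  obtain ⟨a, ha⟩ := ENat.ne_top_iff_exists.1 hfin
  rw [← ha] at h ⊢
  rw [← h] at h3 hgt
  have h3' : a + 1 ≤ 3 := by exact_mod_cast h3
  have hgt' : ¬ a + 1 ≤ 2 := fun hh => hgt (by exact_mod_cast hh)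
  exact_mod_cast (by omega : a = 2)

/-- The non-representatives: one point of every fat class. -/
def delSet (M : Matroid α) (e : α) : Set α := {x | x ∈ M.E ∧ x ≠ e ∧ rep M e x ≠ x}

/-- The matroid of the representatives: `N′ = (M ／ {e}) ＼ delSet`. -/
noncomputable def Nprime (M : Matroid α) (e : α) : Matroid α := (M ／ {e}) ＼ delSet M e

/-- `N′` is finite. -/
instance Nprime_finite (M : Matroid α) [M.Finite] (e : α) : (Nprime M e).Finite := by
  unfold Nprime; infer_instance

/-- The ground set of `N′` is the set of representatives. -/
theorem Nprime_ground (M : Matroid α) (e : α) :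
    (Nprime M e).E = {x | x ∈ M.E ∧ x ≠ e ∧ rep M e x = x} := by
  ext x
  simp only [Nprime, Matroid.delete_ground, Matroid.contract_ground, delSet, mem_sdiff, mem_singleton_iff,
    mem_setOf_eq]
  tauto

/-- Membership in the ground set of `N′`. -/
theorem mem_Nprime_ground {M : Matroid α} {e x : α} :
    x ∈ (Nprime M e).E ↔ x ∈ M.E ∧ x ≠ e ∧ rep M e x = x := by
  rw [Nprime_ground]; rfl

/-- A representative is a point of `N′`. -/
theorem rep_mem_Nprime (M : Matroid α) [M.Finite]
    (hfree : ∀ e ∈ M.E, ∃ A ⊆ M.E \ {e}, e ∉ M.closure A ∧ e ∉ M.closure ((M.E \ {e}) \ A))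
    {e x : α} (he : e ∈ M.E) (hx : x ∈ M.E) (hxe : x ≠ e) : rep M e x ∈ (Nprime M e).E :=
  mem_Nprime_ground.2 ⟨rep_mem_ground M hx hxe, rep_ne M hx hxe, rep_rep M hfree he hx hxe⟩

/-- Ranks in `N′` are ranks in `N` on subsets of `N′`'s ground set. -/
theorem Nprime_eRk_eq (M : Matroid α) (e : α) {X : Set α} (hX : X ⊆ (Nprime M e).E) :
    (Nprime M e).eRk X = (M ／ {e}).eRk X := by
  unfold Nprime at hX ⊢
  rw [Matroid.delete_eq_restrict, Matroid.restrict_eRk_eq]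
  rw [Matroid.delete_ground] at hX
  exact hX

/-- Every point of `N` lies in the closure of its representative: `N.E ⊆ cl_N (N′.E)`. -/
theorem contract_closure_Nprime (M : Matroid α) [M.Finite]
    (hfree : ∀ e ∈ M.E, ∃ A ⊆ M.E \ {e}, e ∉ M.closure A ∧ e ∉ M.closure ((M.E \ {e}) \ A))
    {e : α} (he : e ∈ M.E) : (M ／ {e}).closure (Nprime M e).E = (M ／ {e}).E := by
  refine le_antisymm (Matroid.closure_subset_ground _ _) ?_
  intro x hx
  rw [Matroid.contract_ground, mem_sdiff, mem_singleton_iff] at hx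
  have hrep : rep M e x ∈ (Nprime M e).E := rep_mem_Nprime M hfree he hx.1 hx.2
  have h1 : x ∈ (M ／ {e}).closure {rep M e x} := by
    rw [Matroid.contract_closure_eq, mem_sdiff, mem_singleton_iff]
    refine ⟨?_, hx.2⟩
    have hset : ({rep M e x} : Set α) ∪ {e} = {e, rep M e x} := by ext z; simp only [mem_union, mem_insert_iff, mem_singleton_iff]; tauto
    rw [hset]
    have hsub := insert_cls_subset_closure M hfree he (rep_mem_ground M hx.1 hx.2) (rep_ne M hx.1 hx.2)
    rw [cls_rep M hfree he hx.1 hx.2] at hsub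
    exact hsub (mem_insert_of_mem _ (mem_cls_self M hx.1 hx.2))
  exact (Matroid.closure_subset_closure _ (singleton_subset_iff.2 hrep)) h1

/-- `N′` has the rank of `N`. -/
theorem Nprime_eRank (M : Matroid α) [M.Finite]
    (hfree : ∀ e ∈ M.E, ∃ A ⊆ M.E \ {e}, e ∉ M.closure A ∧ e ∉ M.closure ((M.E \ {e}) \ A))
    {e : α} (he : e ∈ M.E) : (Nprime M e).eRank = (M ／ {e}).eRank := by
  rw [Matroid.eRank_def, Nprime_eRk_eq M e subset_rfl, ← Matroid.eRk_closure_eq,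
    contract_closure_Nprime M hfree he, Matroid.eRank_def]

/-- The nullity of `N′`: `|N′.E| = r(N′) + d′` with `d′ + |delSet| = d`. -/
theorem Nprime_nullity (M : Matroid α) [M.Finite]
    (hfree : ∀ e ∈ M.E, ∃ A ⊆ M.E \ {e}, e ∉ M.closure A ∧ e ∉ M.closure ((M.E \ {e}) \ A))
    {e : α} (he : e ∈ M.E) {d : ℕ} (hd : M.E.encard = M.eRank + d) :
    ∃ d' : ℕ, (Nprime M e).E.encard = (Nprime M e).eRank + d' ∧ d' + (delSet M e).ncard = d := by
  have hν : M✶.eRank = (d : ℕ∞) := by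
    have h := _root_.Matroid.eRank_add_eRank_dual M
    rw [hd] at h
    exact WithTop.add_left_cancel (PercRepro.Matroid.eRank_ne_top_of_finite M) h
  have hν' : (M ／ {e})✶.eRank = (d : ℕ∞) := by
    rw [PercRepro.Matroid.dual_eRank_contract_singleton (indep_singleton_of_free M hfree he), hν]
  have hN : (M ／ {e}).E.encard = (M ／ {e}).eRank + d := by
    have h := _root_.Matroid.eRank_add_eRank_dual (M ／ {e})
    rw [hν'] at h
    exact h.symm
  have hDsub : delSet M e ⊆ (M ／ {e}).E := by
    intro x hx
    rw [Matroid.contract_ground, mem_sdiff, mem_singleton_iff]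
    exact ⟨hx.1, hx.2.1⟩
  have hsplit : ((M ／ {e}).E \ delSet M e).encard + (delSet M e).encard = (M ／ {e}).E.encard :=
    encard_sdiff_add_encard_of_subset hDsub
  have hN'E : (Nprime M e).E = (M ／ {e}).E \ delSet M e := rfl
  have hrk := Nprime_eRank M hfree he
  -- everything finite: pass to ℕ
  have hEfin : (M ／ {e}).E.Finite := M.ground_finite.subset (Matroid.contract_ground_subset_ground M _)
  have hDfin : (delSet M e).Finite := hEfin.subset hDsub
  have hN'fin : (Nprime M e).E.Finite := by rw [hN'E]; exact hEfin.subset sdiff_subset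
  have hrne : (M ／ {e}).eRank ≠ ⊤ :=
    ((Matroid.eRank_le_encard_ground _).trans_lt hEfin.encard_lt_top).ne
  obtain ⟨r, hr⟩ := ENat.ne_top_iff_exists.1 hrne
  have hle : (Nprime M e).eRank ≤ (Nprime M e).E.encard := Matroid.eRank_le_encard_ground _
  rw [hrk, ← hr] at hle
  rw [← hr] at hN
  rw [← hN'E] at hsplit
  rw [← hEfin.cast_ncard_eq] at hN hsplit
  rw [← hDfin.cast_ncard_eq, ← hN'fin.cast_ncard_eq] at hsplit
  rw [← hN'fin.cast_ncard_eq] at hle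
  have hN' : (M ／ {e}).E.ncard = r + d := by exact_mod_cast hN
  have hsplit' : (Nprime M e).E.ncard + (delSet M e).ncard = (M ／ {e}).E.ncard := by exact_mod_cast hsplit
  have hle' : r ≤ (Nprime M e).E.ncard := by exact_mod_cast hle
  refine ⟨(Nprime M e).E.ncard - r, ?_, by omega⟩
  rw [hrk, ← hr, ← hN'fin.cast_ncard_eq]
  have : (Nprime M e).E.ncard = r + ((Nprime M e).E.ncard - r) := by omega
  exact_mod_cast this


end FourCircuitCap

end PercRepro
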